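import Mathlib.LinearAlgebra.Matrix.Rank
import Mathlib.LinearAlgebra.FiniteDimensional.Lemmas
import Mathlib.FieldTheory.IsAlgClosed.Basic
import Mathlib.Algebra.MvPolynomial.Degrees
import HarnessLib
import Literature.Computability.AlgebraicComplexity.MatrixMultiplicationExponent

/-!
# Barriers for rank methods (Efremenko–Garg–Oliveira–Wigderson 2018)

Topic: `Literature/Computability/AlgebraicComplexity`. Work item `wi-03856` (a): the *rank-method
barrier* for the routes `Depth4` (kill criterion "every rank-of-linear-image measure is small")
and `Elusive` of `ValiantsHypothesis`, and for `BorderRankLowerBound` of `MatrixMultiplication`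
(`MatMulRankLowerBounds.lean` defers "the rank-method barrier of EGOW 2018, Thm 4.4 (needs the
notion of a rank method)" to this file).

## The framework (EGOW 2018, §1.1)

Fix a vector space `Ŝ` of "polynomials" and a set `S ⊆ Ŝ` of *simple* ones. The
`S`-complexity `c_S(f)` of `f ∈ Ŝ` is the least `s` with `f = g₁ + ⋯ + g_s`, `gᵢ ∈ S`
(`sComplexity`; tensor rank and Waring rank are the two instances treated in the paper).
A *rank method* is the sub-additive measure `μ_L(f) = rank_F (L f)` attached to a linear map
`L : Ŝ → Mat_m(F)` (`rankMeasure`); sub-additivity gives the lower bound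
`c_S(f) ≥ μ_L(f) / μ_L(S)` (`rankMeasure_div_le_sComplexity`, proved). A *barrier* for rank
methods with constant `c` says `μ_L(f) ≤ c · μ_L(S)` for every `L` and every `f ∈ Ŝ`, i.e. no rank
method certifies a lower bound better than `c` (`RankMethodCeiling F S T c`, with `T = Ŝ`; the
paper's `c(Δ₀^S) ≤ c`).

## Named facts (no proofs)

* `EGOW2018_thm44` — **Theorem 4.4** (tensor rank): for a linear `L : Ten_{n,d}(F) → Mat_m(F)` with
  `rank L(u₁ ⊗ ⋯ ⊗ u_d) ≤ r` on rank-one tensors, `rank L(T) ≤ r · 2^d · n^{⌊d/2⌋}` for every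
  tensor `T`; packaged as the ceiling `EGOW2018_thm11` (**Theorem 1.1** / **Corollary 4.5**:
  `c(Δ₀^T) ≤ 2^d · n^{⌊d/2⌋}`), and for `d = 3` the ceiling `8n` (`EGOW2018_thm11.three`).
* `EGOW2018_thm42` — **Theorem 4.2** (Waring rank): for a linear `L : F[x₁..x_n] → Mat_m(F)` with
  `rank L(ℓ^d) ≤ r` for every *affine* form `ℓ`, `rank L(f) ≤ r · (d+1) · C(n+⌊d/2⌋, n)` for every
  `f` of degree `≤ d`; packaged as `EGOW2018_thm12` (**Theorem 1.2** / **Corollary 4.3**: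
  `c(Δ₀^W) ≤ (d+1) · C(n+⌊d/2⌋, n)`).

Both are stated, as in the paper's standing assumption (§2.1, "we will work over a field `F`
which is algebraically closed and of characteristic zero"), for `[IsAlgClosed F] [CharZero F]`;
the footnote there claims more (large characteristic suffices) but we vendor only what is
proved as printed. The positivity hypotheses `0 < m`, `0 < n` are the paper's ("Let `m, n ∈ ℕ` be
positive integers"); `RankMethodCeiling.apply` removes `0 < m` (a `0 × 0` matrix has rank `0`).

## References

* [EfremenkoGargOliveiraWigderson2018] K. Efremenko, A. Garg, R. Oliveira, A. Wigderson,
  *Barriers for rank methods in arithmetic complexity*, ITCS 2018, LIPIcs 94, 1:1–1:19;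
  arXiv:1710.09502. Numbering as in the arXiv version (verified: §1.1 pp. 3–5, Thm 1.1 p. 5,
  Thm 1.2 p. 6, Def 4.1 / Thm 4.2 / Cor 4.3 p. 12, Thm 4.4 p. 13, Cor 4.5 p. 14).

## Design notes

* Tensors `Ten_{n,d}(F)` are coordinate arrays `(Fin d → Fin n) → F`; rank-one tensors are
  `rankOneTensor u = (i ↦ ∏ j, u j (i j))`. For `d = 3` this is the tree's `triad` after
  uncurrying (`rankOneTensor_three`). `tensorRankD` is `sComplexity` of the rank-one tensors.
* `RankMethodCeiling F S T c` quantifies over *all* `m > 0` and all linear `L`, exactly the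
  generality stressed in §1.1 ("we do not restrict the size `m` … we demand no explicitness").
  Any upper bound `r` of `μ_L` on `S` may be used; taking `r = max_{g ∈ S} μ_L(g)` recovers
  `c(Δ₀^S) ≤ c` literally.
* Waring rank (Def 4.1) uses *linear* forms and homogeneous `f`; Theorem 4.2 as printed
  assumes the rank bound for all *affine* forms and concludes for all `f` of degree `≤ d`. We
  vendor Theorem 4.2 verbatim (`affinePowers`), and define `polyWaringRank` (Def 4.1) with
  `linearPowers` separately.
-/

noncomputable section

open scoped BigOperators
open MvPolynomial

namespace Literature.Computability.AlgebraicComplexity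

/-! ## Rank is sub-additive -/

section MatrixRank

variable {F : Type*} [Field F] {m n : Type*} [Fintype n]

/-- Sub-additivity of matrix rank: `rank (A + B) ≤ rank A + rank B` (the property that makes
`μ_L` a sub-additive measure, EGOW 2018 §1.1 "The rank function of matrices … is sub-additive").
[cite: EfremenkoGargOliveiraWigderson2018, §1.1] -/
theorem matrix_rank_add_le (A B : Matrix m n F) : (A + B).rank ≤ A.rank + B.rank := by
  unfold Matrix.rank
  rw [Matrix.mulVecLin_add]
  calc Module.finrank F ↥(LinearMap.range (A.mulVecLin + B.mulVecLin))
      ≤ Module.finrank F ↥(LinearMap.range A.mulVecLin ⊔ LinearMap.range B.mulVecLin) :=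
        Submodule.finrank_mono (LinearMap.range_add_le _ _)
    _ ≤ _ := Submodule.finrank_add_le_finrank_add_finrank _ _

/-- Sub-additivity of matrix rank over finite sums. [cite: EfremenkoGargOliveiraWigderson2018, §1.1] -/
theorem matrix_rank_sum_le {ι : Type*} (s : Finset ι) (A : ι → Matrix m n F) :
    (∑ i ∈ s, A i).rank ≤ ∑ i ∈ s, (A i).rank := by
  classical
  induction s using Finset.induction_on with
  | empty => simp
  | insert a s ha ih =>
    rw [Finset.sum_insert ha, Finset.sum_insert ha]
    exact (matrix_rank_add_le _ _).trans (by gcongr)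

end MatrixRank

/-! ## `S`-complexity and rank measures (EGOW 2018, §1.1) -/

section Complexity

variable {V : Type*} [AddCommMonoid V]

/-- The **`S`-complexity** `c_S(f)`: the least `s` such that `f = g₁ + ⋯ + g_s` with every
`gᵢ ∈ S` (EGOW 2018, §1.1). Tensor rank (`S` = rank-one tensors) and Waring rank (`S` = `d`-th
powers of linear forms) are instances. Junk value `0` (`sInf ∅`) when `f` is not a finite sum of
elements of `S`. [cite: EfremenkoGargOliveiraWigderson2018, §1.1] -/
def sComplexity (S : Set V) (f : V) : ℕ :=
  sInf {s | ∃ g : Fin s → V, (∀ i, g i ∈ S) ∧ ∑ i, g i = f}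

/-- A decomposition into `s` simple pieces bounds the `S`-complexity by `s`. [cite: EfremenkoGargOliveiraWigderson2018, §1.1] -/
theorem sComplexity_le_of_eq_sum {S : Set V} {f : V} {s : ℕ} (g : Fin s → V) (hg : ∀ i, g i ∈ S)
    (hf : ∑ i, g i = f) : sComplexity S f ≤ s :=
  Nat.sInf_le ⟨g, hg, hf⟩

/-- `c_S(0) = 0` (the empty sum). [cite: EfremenkoGargOliveiraWigderson2018, §1.1] -/
@[simp] theorem sComplexity_zero (S : Set V) : sComplexity S (0 : V) = 0 :=
  Nat.le_zero.1 (sComplexity_le_of_eq_sum (S := S) Fin.elim0 (fun i => i.elim0) (by simp))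

/-- If `f` has some decomposition over `S`, the infimum defining `c_S(f)` is attained. [cite: EfremenkoGargOliveiraWigderson2018, §1.1] -/
theorem sComplexity_spec {S : Set V} {f : V}
    (hf : ∃ s : ℕ, ∃ g : Fin s → V, (∀ i, g i ∈ S) ∧ ∑ i, g i = f) :
    ∃ g : Fin (sComplexity S f) → V, (∀ i, g i ∈ S) ∧ ∑ i, g i = f :=
  Nat.sInf_mem (s := {s | ∃ g : Fin s → V, (∀ i, g i ∈ S) ∧ ∑ i, g i = f}) hf

/-- `c_S` is antitone in `S` (on elements that do decompose over the smaller set). [cite: EfremenkoGargOliveiraWigderson2018, §1.1] -/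
theorem sComplexity_anti {S S' : Set V} (hSS' : S ⊆ S') {f : V}
    (hf : ∃ s : ℕ, ∃ g : Fin s → V, (∀ i, g i ∈ S) ∧ ∑ i, g i = f) :
    sComplexity S' f ≤ sComplexity S f := by
  obtain ⟨g, hg, hgf⟩ := sComplexity_spec hf
  exact sComplexity_le_of_eq_sum g (fun i => hSS' (hg i)) hgf

end Complexity

section RankMeasure

variable {F : Type*} [Field F] {V : Type*} [AddCommGroup V] [Module F V] {m : ℕ}

/-- The **rank measure** of a linear map `L : Ŝ → Mat_m(F)`: `μ_L(f) = rank_F (L f)`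
(EGOW 2018, §1.1, "Rank methods"). [cite: EfremenkoGargOliveiraWigderson2018, §1.1] -/
def rankMeasure (L : V →ₗ[F] Matrix (Fin m) (Fin m) F) (f : V) : ℕ :=
  (L f).rank

/-- Unfolding lemma. [cite: EfremenkoGargOliveiraWigderson2018, §1.1] -/
theorem rankMeasure_apply (L : V →ₗ[F] Matrix (Fin m) (Fin m) F) (f : V) :
    rankMeasure L f = (L f).rank := rfl

/-- `μ_L` never exceeds the matrix size `m`. [folklore] -/
theorem rankMeasure_le (L : V →ₗ[F] Matrix (Fin m) (Fin m) F) (f : V) : rankMeasure L f ≤ m :=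
  Matrix.rank_le_width _

/-- `μ_L(0) = 0`. [folklore] -/
@[simp] theorem rankMeasure_zero (L : V →ₗ[F] Matrix (Fin m) (Fin m) F) :
    rankMeasure L 0 = 0 := by
  simp [rankMeasure]

/-- `μ_L` is sub-additive (EGOW 2018, §1.1: "all these `μ_L` … are sub-additive measures").
[cite: EfremenkoGargOliveiraWigderson2018, §1.1] -/
theorem rankMeasure_add_le (L : V →ₗ[F] Matrix (Fin m) (Fin m) F) (f g : V) :
    rankMeasure L (f + g) ≤ rankMeasure L f + rankMeasure L g := by
  simp only [rankMeasure, map_add]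
  exact matrix_rank_add_le _ _

/-- `μ_L` is sub-additive over finite sums. [cite: EfremenkoGargOliveiraWigderson2018, §1.1] -/
theorem rankMeasure_sum_le (L : V →ₗ[F] Matrix (Fin m) (Fin m) F) {ι : Type*} (s : Finset ι)
    (g : ι → V) : rankMeasure L (∑ i ∈ s, g i) ≤ ∑ i ∈ s, rankMeasure L (g i) := by
  simp only [rankMeasure, map_sum]
  exact matrix_rank_sum_le _ _

/-- The rank-method lower bound, multiplicative form: if `μ_L ≤ r` on `S` and
`f = g₁ + ⋯ + g_s` with `gᵢ ∈ S`, then `μ_L(f) ≤ s · r` (EGOW 2018, §1.1). [cite: EfremenkoGargOliveiraWigderson2018, §1.1] -/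
theorem rankMeasure_le_mul_of_eq_sum (L : V →ₗ[F] Matrix (Fin m) (Fin m) F) {S : Set V} {r : ℕ}
    (hr : ∀ g ∈ S, rankMeasure L g ≤ r) {s : ℕ} (g : Fin s → V) (hg : ∀ i, g i ∈ S) {f : V}
    (hf : ∑ i, g i = f) : rankMeasure L f ≤ s * r := by
  rw [← hf]
  calc rankMeasure L (∑ i, g i) ≤ ∑ i, rankMeasure L (g i) := rankMeasure_sum_le L _ _
    _ ≤ ∑ _i : Fin s, r := Finset.sum_le_sum fun i _ => hr _ (hg i)
    _ = s * r := by simp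

/-- The rank-method lower bound `c_S(f) · μ_L(S) ≥ μ_L(f)` (EGOW 2018, §1.1,
"`c_S(f) ≥ μ(f)/μ(S)`"), for `f` in the span of `S`. [cite: EfremenkoGargOliveiraWigderson2018, §1.1] -/
theorem rankMeasure_le_sComplexity_mul (L : V →ₗ[F] Matrix (Fin m) (Fin m) F) {S : Set V}
    {r : ℕ} (hr : ∀ g ∈ S, rankMeasure L g ≤ r) {f : V}
    (hf : ∃ s : ℕ, ∃ g : Fin s → V, (∀ i, g i ∈ S) ∧ ∑ i, g i = f) :
    rankMeasure L f ≤ sComplexity S f * r := by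
  obtain ⟨g, hg, hgf⟩ := sComplexity_spec hf
  exact rankMeasure_le_mul_of_eq_sum L hr g hg hgf

/-- The rank-method lower bound in the paper's quotient form `c_S(f) ≥ μ_L(f)/μ_L(S)` (natural
number division; `r > 0` any upper bound of `μ_L` on `S`). [cite: EfremenkoGargOliveiraWigderson2018, §1.1] -/
theorem rankMeasure_div_le_sComplexity (L : V →ₗ[F] Matrix (Fin m) (Fin m) F) {S : Set V}
    {r : ℕ} (hr : ∀ g ∈ S, rankMeasure L g ≤ r) {f : V}
    (hf : ∃ s : ℕ, ∃ g : Fin s → V, (∀ i, g i ∈ S) ∧ ∑ i, g i = f) :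
    rankMeasure L f / r ≤ sComplexity S f :=
  Nat.div_le_of_le_mul (by rw [Nat.mul_comm]; exact rankMeasure_le_sComplexity_mul L hr hf)

end RankMeasure

/-! ## Barriers: the ceiling `c(Δ₀^S)` of rank methods -/

section Ceiling

variable (F : Type*) [Field F] {V : Type*} [AddCommGroup V] [Module F V]

/-- **Rank-method ceiling** (barrier constant). `RankMethodCeiling F S T c` says: for every matrix
size `m > 0`, every `F`-linear `L : V → Mat_m(F)` and every `r` with `rank (L g) ≤ r` for all
simple `g ∈ S`, one has `rank (L f) ≤ c · r` for all `f ∈ T`. With `T = Ŝ` (the span of `S`) this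
is EGOW's `c(Δ₀^S) ≤ c` (§1.1, "Barriers for sub-additive measures" and "Rank methods"): no rank
method proves an `S`-complexity lower bound better than `c` on any `f ∈ T`
(`RankMethodCeiling.div_le`). [cite: EfremenkoGargOliveiraWigderson2018, §1.1] -/
def RankMethodCeiling (S T : Set V) (c : ℕ) : Prop :=
  ∀ (m : ℕ), 0 < m → ∀ (L : V →ₗ[F] Matrix (Fin m) (Fin m) F) (r : ℕ),
    (∀ g ∈ S, (L g).rank ≤ r) → ∀ f ∈ T, (L f).rank ≤ c * r

variable {F}

namespace RankMethodCeiling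

variable {S T : Set V} {c : ℕ}

/-- Apply a ceiling to a concrete rank method (the case `m = 0` is trivial: a `0 × 0` matrix has
rank `0`). [cite: EfremenkoGargOliveiraWigderson2018, §1.1] -/
theorem apply (h : RankMethodCeiling F S T c) {m : ℕ} (L : V →ₗ[F] Matrix (Fin m) (Fin m) F)
    {r : ℕ} (hr : ∀ g ∈ S, (L g).rank ≤ r) {f : V} (hf : f ∈ T) : (L f).rank ≤ c * r := by
  rcases Nat.eq_zero_or_pos m with rfl | hm
  · exact (Matrix.rank_le_width (L f)).trans (Nat.zero_le _)
  · exact h m hm L r hr f hf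

/-- The same in `rankMeasure` notation: `μ_L(f) ≤ c · r` whenever `μ_L ≤ r` on `S`. [cite: EfremenkoGargOliveiraWigderson2018, §1.1] -/
theorem rankMeasure_le (h : RankMethodCeiling F S T c) {m : ℕ}
    (L : V →ₗ[F] Matrix (Fin m) (Fin m) F) {r : ℕ} (hr : ∀ g ∈ S, rankMeasure L g ≤ r) {f : V}
    (hf : f ∈ T) : rankMeasure L f ≤ c * r :=
  h.apply L hr hf

/-- **The barrier.** Under a ceiling `c`, the lower bound `μ_L(f)/r` that the rank method `L`
certifies for `c_S(f)` (cf. `rankMeasure_div_le_sComplexity`) is itself at most `c`, for every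
`f ∈ T` and every bound `r > 0` of `μ_L` on `S` (EGOW 2018, §1.1: "`μ(f) ≤ c(Δ) · μ(S)` for all of
them"). [cite: EfremenkoGargOliveiraWigderson2018, §1.1] -/
theorem div_le (h : RankMethodCeiling F S T c) {m : ℕ} (L : V →ₗ[F] Matrix (Fin m) (Fin m) F)
    {r : ℕ} (hr : ∀ g ∈ S, (L g).rank ≤ r) {f : V} (hf : f ∈ T) :
    (L f).rank / r ≤ c :=
  Nat.div_le_of_le_mul (by rw [Nat.mul_comm]; exact h.apply L hr hf)

/-- Monotonicity: enlarging the simple set, shrinking the target set, or raising the constant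
preserves a ceiling. [folklore] -/
theorem mono (h : RankMethodCeiling F S T c) {S' T' : Set V} {c' : ℕ} (hS : S ⊆ S')
    (hT : T' ⊆ T) (hc : c ≤ c') : RankMethodCeiling F S' T' c' :=
  fun m hm L r hr f hf =>
    (h m hm L r (fun g hg => hr g (hS hg)) f (hT hf)).trans (Nat.mul_le_mul_right _ hc)

/-- The trivial ceiling on the simple set itself: `c = 1`. [folklore] -/
theorem self (S : Set V) : RankMethodCeiling F S S 1 :=
  fun _ _ _ _ hr f hf => by simpa using hr f hf

end RankMethodCeiling

end Ceiling

/-! ## Tensors `Ten_{n,d}(F)` and rank-one tensors -/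

section Tensor

variable {F : Type*} [CommSemiring F] {n d : ℕ}

/-- The rank-one tensor `u₀ ⊗ u₁ ⊗ ⋯ ⊗ u_{d-1} ∈ Ten_{n,d}(F) = F^{[n]^d}`, entry `∏ⱼ uⱼ(iⱼ)` at the
multi-index `i : Fin d → Fin n` (EGOW 2018, §1.2 "Tensor rank": "the coefficients are described
by the tensor product of `d` vectors"). [cite: EfremenkoGargOliveiraWigderson2018, §1.2] -/
def rankOneTensor (u : Fin d → Fin n → F) : (Fin d → Fin n) → F :=
  fun i => ∏ j, u j (i j)

/-- Unfolding lemma. [cite: EfremenkoGargOliveiraWigderson2018, §1.2] -/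
theorem rankOneTensor_apply (u : Fin d → Fin n → F) (i : Fin d → Fin n) :
    rankOneTensor u i = ∏ j, u j (i j) := rfl

variable (F n d) in
/-- The set of rank-one tensors in `Ten_{n,d}(F)` — the "simple polynomials" `S` of the tensor-rank
instance of the framework (EGOW 2018, §1.2). [cite: EfremenkoGargOliveiraWigderson2018, §1.2] -/
def rankOneTensors : Set ((Fin d → Fin n) → F) :=
  Set.range (rankOneTensor (F := F) (n := n) (d := d))

/-- Membership. [cite: EfremenkoGargOliveiraWigderson2018, §1.2] -/
theorem rankOneTensor_mem (u : Fin d → Fin n → F) : rankOneTensor u ∈ rankOneTensors F n d :=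
  ⟨u, rfl⟩

/-- For `d = 3` a rank-one tensor is the tree's `triad`, uncurried:
`(u₀ ⊗ u₁ ⊗ u₂)(i) = u₀(i 0) · u₁(i 1) · u₂(i 2) = triad u₀ u₁ u₂ (i 0) (i 1) (i 2)`. [cite: EfremenkoGargOliveiraWigderson2018, §1.2] -/
theorem rankOneTensor_three (u : Fin 3 → Fin n → F) (i : Fin 3 → Fin n) :
    rankOneTensor u i = triad (u 0) (u 1) (u 2) (i 0) (i 1) (i 2) := by
  simp [rankOneTensor, Fin.prod_univ_three, triad]

/-- The **tensor rank** of a `d`-dimensional tensor of side `n`: the least number of rank-one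
tensors summing to it (EGOW 2018, §1.2: "The tensor rank of a tensor `f` is the smallest number
of rank-1 tensors which add up to it"); the `S`-complexity for `S` = rank-one tensors. [cite: EfremenkoGargOliveiraWigderson2018, §1.2] -/
def tensorRankD (T : (Fin d → Fin n) → F) : ℕ :=
  sComplexity (rankOneTensors F n d) T

/-- A decomposition into `s` rank-one tensors bounds the tensor rank. [cite: EfremenkoGargOliveiraWigderson2018, §1.2] -/
theorem tensorRankD_le_of_eq_sum {T : (Fin d → Fin n) → F} {s : ℕ} (u : Fin s → Fin d → Fin n → F)
    (hT : ∑ k, rankOneTensor (u k) = T) : tensorRankD T ≤ s :=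
  sComplexity_le_of_eq_sum (fun k => rankOneTensor (u k)) (fun k => rankOneTensor_mem (u k)) hT

/-- Rank-one tensors have tensor rank `≤ 1`. [cite: EfremenkoGargOliveiraWigderson2018, §1.2] -/
theorem tensorRankD_rankOneTensor_le (u : Fin d → Fin n → F) : tensorRankD (rankOneTensor u) ≤ 1 :=
  tensorRankD_le_of_eq_sum (fun _ => u) (by simp)

end Tensor

/-! ## EGOW 2018, Theorem 4.4 / Theorem 1.1: the tensor-rank barrier -/

section TensorBarrier

/-- **Efremenko–Garg–Oliveira–Wigderson 2018, Theorem 4.4 (Tensor Rank Upper Bounds).** Over an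
algebraically closed field `F` of characteristic zero (standing assumption, §2.1): let `m, n` be
positive integers and `L : Ten_{n,d}(F) → Mat_m(F)` a linear map such that every rank-one tensor
is mapped to a matrix of rank `≤ r`, `rank L(u₁ ⊗ ⋯ ⊗ u_d) ≤ r`. Then
`rank L(T) ≤ r · 2^d · n^{⌊d/2⌋}` for every tensor `T ∈ Ten_{n,d}(F)`. [cite: EfremenkoGargOliveiraWigderson2018, Thm 4.4] -/
def EGOW2018_thm44 : Prop :=
  ∀ (F : Type) [Field F] [IsAlgClosed F] [CharZero F] (m n d : ℕ), 0 < m → 0 < n →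
    ∀ (L : ((Fin d → Fin n) → F) →ₗ[F] Matrix (Fin m) (Fin m) F) (r : ℕ),
      (∀ u : Fin d → Fin n → F, (L (rankOneTensor u)).rank ≤ r) →
      ∀ T : (Fin d → Fin n) → F, (L T).rank ≤ r * 2 ^ d * n ^ (d / 2)

/-- **Efremenko–Garg–Oliveira–Wigderson 2018, Theorem 1.1 / Corollary 4.5** (barrier for tensor
rank): `c(Δ₀^T) ≤ 2^d · n^{⌊d/2⌋}` — rank methods (flattenings `L : Ten_{n,d}(F) → Mat_m(F)`)
cannot prove tensor-rank lower bounds better than `2^d · n^{⌊d/2⌋}` for any `d`-dimensional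
tensor of side `n` (algebraically closed `F` of characteristic zero, `n ≥ 1`). [cite: EfremenkoGargOliveiraWigderson2018, Thm 1.1] -/
def EGOW2018_thm11 : Prop :=
  ∀ (F : Type) [Field F] [IsAlgClosed F] [CharZero F] (n d : ℕ), 0 < n →
    RankMethodCeiling F (rankOneTensors F n d) Set.univ (2 ^ d * n ^ (d / 2))

/-- Theorem 4.4 packaged as the ceiling `c(Δ₀^T) ≤ 2^d n^{⌊d/2⌋}`. [cite: EfremenkoGargOliveiraWigderson2018, Cor 4.5] -/
theorem EGOW2018_thm44.ceiling (h : EGOW2018_thm44) (F : Type) [Field F] [IsAlgClosed F]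
    [CharZero F] {n : ℕ} (hn : 0 < n) (d : ℕ) :
    RankMethodCeiling F (rankOneTensors F n d) Set.univ (2 ^ d * n ^ (d / 2)) := by
  intro m hm L r hr T _
  have h' := h F m n d hm hn L r (fun u => hr _ (rankOneTensor_mem u)) T
  calc (L T).rank ≤ r * 2 ^ d * n ^ (d / 2) := h'
    _ = 2 ^ d * n ^ (d / 2) * r := by ring

/-- Theorem 4.4 implies Theorem 1.1 (this is Corollary 4.5 of the paper). [cite: EfremenkoGargOliveiraWigderson2018, Cor 4.5] -/
theorem EGOW2018_thm44.thm11 (h : EGOW2018_thm44) : EGOW2018_thm11 :=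
  fun F _ _ _ _ d hn => h.ceiling F hn d

/-- The headline case `d = 3`: rank methods cannot prove a tensor-rank lower bound better than
`8n` for any `3`-dimensional tensor of side `n` (EGOW 2018, §1.2: "for `d = 3`, they cannot beat
`8n`"). [cite: EfremenkoGargOliveiraWigderson2018, Thm 1.1] -/
theorem EGOW2018_thm11.three (h : EGOW2018_thm11) (F : Type) [Field F] [IsAlgClosed F]
    [CharZero F] {n : ℕ} (hn : 0 < n) :
    RankMethodCeiling F (rankOneTensors F n 3) Set.univ (8 * n) := by
  simpa using h F n 3 hn

/-- The barrier in quotient form for `3`-tensors: whatever flattening `L` one uses, the certified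
lower bound `rank L(T) / max rank L(u ⊗ v ⊗ w)` is at most `8n`. [cite: EfremenkoGargOliveiraWigderson2018, Thm 1.1] -/
theorem EGOW2018_thm11.three_div_le (h : EGOW2018_thm11) (F : Type) [Field F] [IsAlgClosed F]
    [CharZero F] {n : ℕ} (hn : 0 < n) {m : ℕ}
    (L : ((Fin 3 → Fin n) → F) →ₗ[F] Matrix (Fin m) (Fin m) F) {r : ℕ}
    (hr : ∀ u : Fin 3 → Fin n → F, (L (rankOneTensor u)).rank ≤ r) (T : (Fin 3 → Fin n) → F) :
    (L T).rank / r ≤ 8 * n :=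
  (h.three F hn).div_le L (by rintro _ ⟨u, rfl⟩; exact hr u) (Set.mem_univ T)

end TensorBarrier

/-! ## Affine forms, Waring rank (Def 4.1) and the Waring-rank barrier (Thm 4.2 / Thm 1.2) -/

section Waring

variable {F : Type*} [CommSemiring F] {n : ℕ}

/-- The affine form `ℓ(x) = a₀ + ∑ᵢ aᵢ xᵢ ∈ F[x₁, …, x_n]` (EGOW 2018, proof of Thm 4.2). [cite: EfremenkoGargOliveiraWigderson2018, Thm 4.2] -/
def affineForm (a₀ : F) (a : Fin n → F) : MvPolynomial (Fin n) F :=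
  C a₀ + ∑ i, C (a i) * X i

/-- The linear form `ℓ(x) = ∑ᵢ aᵢ xᵢ` (EGOW 2018, Def 4.1). [cite: EfremenkoGargOliveiraWigderson2018, Def 4.1] -/
def linearForm (a : Fin n → F) : MvPolynomial (Fin n) F :=
  ∑ i, C (a i) * X i

/-- A linear form is the affine form with constant term `0`. [cite: EfremenkoGargOliveiraWigderson2018, Def 4.1] -/
@[simp] theorem affineForm_zero (a : Fin n → F) : affineForm 0 a = linearForm a := by
  simp [affineForm, linearForm]

/-- Affine forms have total degree `≤ 1`. [folklore] -/
theorem totalDegree_affineForm_le (a₀ : F) (a : Fin n → F) : (affineForm a₀ a).totalDegree ≤ 1 := by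
  refine (totalDegree_add _ _).trans (max_le (by simp) ?_)
  refine (totalDegree_finsetSum _ _).trans (Finset.sup_le fun i _ => ?_)
  rw [C_mul_X_eq_monomial]
  exact (totalDegree_monomial_le _ _).trans (by simp [Finsupp.sum_single_index])

variable (F n) in
/-- The set `{ℓ^d : ℓ affine}` of `d`-th powers of affine forms — the simple polynomials of
Theorem 4.2. [cite: EfremenkoGargOliveiraWigderson2018, Thm 4.2] -/
def affinePowers (d : ℕ) : Set (MvPolynomial (Fin n) F) :=
  {p | ∃ (a₀ : F) (a : Fin n → F), affineForm a₀ a ^ d = p}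

variable (F n) in
/-- The set `{ℓ^d : ℓ linear}` of `d`-th powers of linear forms — the simple polynomials of Waring
rank (Def 4.1). [cite: EfremenkoGargOliveiraWigderson2018, Def 4.1] -/
def linearPowers (d : ℕ) : Set (MvPolynomial (Fin n) F) :=
  {p | ∃ a : Fin n → F, linearForm a ^ d = p}

/-- Powers of linear forms are powers of affine forms. [cite: EfremenkoGargOliveiraWigderson2018, Def 4.1] -/
theorem linearPowers_subset_affinePowers (d : ℕ) : linearPowers F n d ⊆ affinePowers F n d := by
  rintro _ ⟨a, rfl⟩
  exact ⟨0, a, by simp⟩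

/-- Elements of `affinePowers F n d` have total degree `≤ d`. [folklore] -/
theorem totalDegree_le_of_mem_affinePowers {d : ℕ} {p : MvPolynomial (Fin n) F}
    (hp : p ∈ affinePowers F n d) : p.totalDegree ≤ d := by
  obtain ⟨a₀, a, rfl⟩ := hp
  refine (totalDegree_pow _ _).trans ?_
  simpa using Nat.mul_le_mul_left d (totalDegree_affineForm_le a₀ a)

/-- **Waring rank** (EGOW 2018, Definition 4.1): the least `r` such that `f = ∑_{i ≤ r} ℓᵢ^d` with
linear forms `ℓᵢ`; the `S`-complexity for `S = linearPowers F n d`. Junk value `0` when `f` has no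
such expression (e.g. `f` not homogeneous of degree `d`, or small characteristic). [cite: EfremenkoGargOliveiraWigderson2018, Def 4.1] -/
def polyWaringRank (d : ℕ) (f : MvPolynomial (Fin n) F) : ℕ :=
  sComplexity (linearPowers F n d) f

/-- A Waring decomposition of length `s` bounds the Waring rank by `s`. [cite: EfremenkoGargOliveiraWigderson2018, Def 4.1] -/
theorem polyWaringRank_le_of_eq_sum {d s : ℕ} (a : Fin s → Fin n → F) {f : MvPolynomial (Fin n) F}
    (hf : ∑ k, linearForm (a k) ^ d = f) : polyWaringRank d f ≤ s :=
  sComplexity_le_of_eq_sum (fun k => linearForm (a k) ^ d) (fun k => ⟨a k, rfl⟩) hf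

end Waring

section WaringBarrier

/-- **Efremenko–Garg–Oliveira–Wigderson 2018, Theorem 4.2 (Waring Rank Upper Bounds).** Over an
algebraically closed field `F` of characteristic zero (§2.1): let `m, n` be positive integers and
`L : F[x₁, …, x_n] → Mat_m(F)` a linear map. If `rank L(ℓ^d) ≤ r` for every affine form `ℓ`, then
`rank L(f) ≤ r · (d+1) · C(n + ⌊d/2⌋, n)` for every polynomial `f` of degree at most `d`. [cite: EfremenkoGargOliveiraWigderson2018, Thm 4.2] -/
def EGOW2018_thm42 : Prop :=
  ∀ (F : Type) [Field F] [IsAlgClosed F] [CharZero F] (m n d : ℕ), 0 < m → 0 < n →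
    ∀ (L : MvPolynomial (Fin n) F →ₗ[F] Matrix (Fin m) (Fin m) F) (r : ℕ),
      (∀ (a₀ : F) (a : Fin n → F), (L (affineForm a₀ a ^ d)).rank ≤ r) →
      ∀ f : MvPolynomial (Fin n) F, f.totalDegree ≤ d →
        (L f).rank ≤ r * (d + 1) * Nat.choose (n + d / 2) n

/-- **Efremenko–Garg–Oliveira–Wigderson 2018, Theorem 1.2 / Corollary 4.3** (barrier for Waring
rank): `c(Δ₀^W) ≤ (d+1) · C(n + ⌊d/2⌋, n)` — rank methods `L : F[x] → Mat_m(F)` cannot prove Waring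
rank lower bounds better than `(d+1) · C(n + ⌊d/2⌋, n)` for any polynomial of degree `≤ d`
(algebraically closed `F` of characteristic zero, `n ≥ 1`; simple set = `d`-th powers of affine
forms as in the printed proof of Cor 4.3). [cite: EfremenkoGargOliveiraWigderson2018, Thm 1.2] -/
def EGOW2018_thm12 : Prop :=
  ∀ (F : Type) [Field F] [IsAlgClosed F] [CharZero F] (n d : ℕ), 0 < n →
    RankMethodCeiling F (affinePowers F n d) {f | f.totalDegree ≤ d}
      ((d + 1) * Nat.choose (n + d / 2) n)

/-- Theorem 4.2 packaged as the ceiling `c(Δ₀^W) ≤ (d+1)·C(n+⌊d/2⌋, n)`. [cite: EfremenkoGargOliveiraWigderson2018, Cor 4.3] -/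
theorem EGOW2018_thm42.ceiling (h : EGOW2018_thm42) (F : Type) [Field F] [IsAlgClosed F]
    [CharZero F] {n : ℕ} (hn : 0 < n) (d : ℕ) :
    RankMethodCeiling F (affinePowers F n d) {f | f.totalDegree ≤ d}
      ((d + 1) * Nat.choose (n + d / 2) n) := by
  intro m hm L r hr f hf
  have h' := h F m n d hm hn L r (fun a₀ a => hr _ ⟨a₀, a, rfl⟩) f hf
  calc (L f).rank ≤ r * (d + 1) * Nat.choose (n + d / 2) n := h'
    _ = (d + 1) * Nat.choose (n + d / 2) n * r := by ring

/-- Theorem 4.2 implies Theorem 1.2 (Corollary 4.3 of the paper). [cite: EfremenkoGargOliveiraWigderson2018, Cor 4.3] -/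
theorem EGOW2018_thm42.thm12 (h : EGOW2018_thm42) : EGOW2018_thm12 :=
  fun F _ _ _ _ d hn => h.ceiling F hn d

/-- Corollary 4.3 in quotient form: for any linear `L` with `rank L(ℓ^d) ≤ r` (`ℓ` affine, `r > 0`
or not) and any `f` of degree `≤ d`, the certified bound `rank L(f) / r` is at most
`(d+1)·C(n+⌊d/2⌋, n)`. [cite: EfremenkoGargOliveiraWigderson2018, Cor 4.3] -/
theorem EGOW2018_thm12.div_le (h : EGOW2018_thm12) (F : Type) [Field F] [IsAlgClosed F]
    [CharZero F] {n : ℕ} (hn : 0 < n) (d : ℕ) {m : ℕ}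
    (L : MvPolynomial (Fin n) F →ₗ[F] Matrix (Fin m) (Fin m) F) {r : ℕ}
    (hr : ∀ (a₀ : F) (a : Fin n → F), (L (affineForm a₀ a ^ d)).rank ≤ r)
    {f : MvPolynomial (Fin n) F} (hf : f.totalDegree ≤ d) :
    (L f).rank / r ≤ (d + 1) * Nat.choose (n + d / 2) n :=
  (h F n d hn).div_le L (by rintro _ ⟨a₀, a, rfl⟩; exact hr a₀ a) hf

/-- The two sides of the barrier for a Waring decomposition over affine powers: the rank method
certifies `rank L(f)/r ≤ c_S(f)` (`S` = affine `d`-th powers) while the ceiling caps the left side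
at `(d+1)·C(n+⌊d/2⌋, n)`; and `c_S(f) ≤ polyWaringRank d f` whenever `f` has a Waring
decomposition (linear powers are affine powers). [cite: EfremenkoGargOliveiraWigderson2018, Cor 4.3] -/
theorem sComplexity_affinePowers_le_polyWaringRank {F : Type*} [Field F] {n d : ℕ}
    {f : MvPolynomial (Fin n) F}
    (hf : ∃ s : ℕ, ∃ g : Fin s → MvPolynomial (Fin n) F, (∀ i, g i ∈ linearPowers F n d) ∧ ∑ i, g i = f) :
    sComplexity (affinePowers F n d) f ≤ polyWaringRank d f :=
  sComplexity_anti (linearPowers_subset_affinePowers d) hf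

end WaringBarrier

end Literature.Computability.AlgebraicComplexity
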